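import Summits.CriticalPhenomena.PercolationContinuityZ3.Theses.PercNecklaceBackbone
import Summits.CriticalPhenomena.PercolationContinuityZ3.Theorems.PercNecklaceBackboneNecklaceCofinalBridges
import Literature.Probability.Percolation.DeletionTolerance
import Literature.Probability.Percolation.ConnectivityProofs
import Literature.Probability.Percolation.CriticalContinuityProofs
import HarnessLib

/-!
# `PercNecklaceBackbone.NecklaceFatTails` (stmt-CriticalPhenomena-5273): the one-edge surgery

Proof of the support item
`Summit.CriticalPhenomena.PercolationContinuityZ3.Theses.PercNecklaceBackbone.NecklaceFatTails`
of route `PercNecklaceBackbone`: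

  `NoBackbone → 0 < θ(p_c) → ¬ Summable (x ↦ P_{p_c}(0 ↔ x, |C(0)| < ∞))`,

i.e. in a "necklace" jump world the truncated susceptibility `χᶠ(p_c) = Σ_x P_{p_c}(0 ↔ x, |C(0)| < ∞)`
is infinite. Write `P = P_{p_c}` (`bondPercolation (zdGraph 3) (criticalProbI 3)`), `C(x) = C_ω(x)`
for the open cluster, `ω ∖ e` for the configuration with the pair `e` closed, and

  `Bad = {ω ⊄ E(ℤ³)} ∪ ⋃_x {ω | ∀ e, x ↔ ∞ in ω ∖ e}`,
  `A_s(x) = {|C(0)| < ∞, s ≤ |C(0)|, x ∈ C(0)}`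

(both written out in full in every statement — this file introduces no definition and no notation).

1. (`measure_bad_eq_zero`) `NoBackbone` says `P{∀ e, 0 ↔ ∞ in ω ∖ e} = 0`; by translation invariance
   (`Necklace.real_backboneAt_eq` of the sibling file `PercNecklaceBackboneNecklaceCofinalBridges.lean`,
   item stmt-CriticalPhenomena-5272) the same holds at every vertex, and a.s. only lattice edges are
   open, so `P(Bad) = 0`; off `Bad` EVERY percolating vertex `z` has a pair `e` with `C_{ω∖e}(z)` finite.
2. (`percolatesAt_diff_subset`) Deterministic surgery (the nesting lemma `Necklace.nesting` and the
   crossing lemma `Necklace.exists_crossing` of the sibling file): for `ω ∈ {0 ↔ ∞} ∖ Bad` and every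
   `s` there is an OPEN lattice edge `{x, y}` with `s ≤ |C_{ω∖{x,y}}(0)| < ∞` and
   `x ∈ C_{ω∖{x,y}}(0)`; hence `{0 ↔ ∞} ∖ Bad ⊆ ⋃_x ⋃_{y ∼ x} {ω | ω ∖ {x,y} ∈ A_s(x)}`.
3. (`measureReal_setOf_sdiff_mem_le`, `real_le_tsum_of_subset`) Deletion tolerance
   (`DeletionTolerance.lean`): `P{ω | ω ∖ e ∈ A} ≤ P(A)/(1 − p_c)` (`p_c(ℤ³) < 1`,
   `criticalProb_zd_lt_one`), and every vertex has `6` neighbours, so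
   `θ(p_c) ≤ 6/(1 − p_c) · Σ_x P(A_s(x))` for EVERY `s` (`real_percolatesAt_le`).
4. `A_s(x) ⊆ {0 ↔ x} ∖ {0 ↔ ∞}` decreases to `∅` as `s → ∞` (`tendsto_measureReal_A`), so if the
   truncated connectivity were summable, Tannery's theorem (`tendsto_tsum_of_dominated_convergence`,
   packaged as `le_zero_of_forall_le_tsum`) would give `Σ_x P(A_s(x)) → 0`, forcing `θ(p_c) ≤ 0`
   (`necklaceFatTails_proof`).

## References

* M. Aizenman, H. Kesten, C. M. Newman, Comm. Math. Phys. 111 (1987), 505–531 (one-edge surgery /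
  finite energy) [AizenmanKestenNewmanCMP1987].
* R. M. Burton, M. Keane, Comm. Math. Phys. 121 (1989), 501–505 [BurtonKeane1989].
* G. Grimmett, *Percolation*, 2nd ed. (1999), §1.3 (product measure), §8.2 [GrimmettPercolation1999].
-/

noncomputable section

namespace Summit.CriticalPhenomena.PercolationContinuityZ3.Theorems

namespace PercNecklaceBackboneNecklaceFatTails

open Literature.Probability.Percolation Literature.Probability.LatticeModels MeasureTheory Filter
open ProbabilityTheory
open scoped Topology ENNReal

/-! ### Step 1: the exceptional set `Bad` is null -/

/-- **`P_{p_c}(Bad) = 0`** under `NoBackbone`: a.s. only lattice edges are open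
(`setBernoulli_ae_subset`), and for every vertex `x`, `P_{p_c}{ω | ∀ e, x ↔ ∞ in ω ∖ e} = 0` by
translation invariance of `NoBackbone` (`Necklace.real_backboneAt_eq`) and countable subadditivity
over the lattice. [folklore] -/
theorem measure_bad_eq_zero
    (hNB : Summit.CriticalPhenomena.PercolationContinuityZ3.Theses.PercNecklaceBackbone.NoBackbone) :
    bondPercolation (zdGraph 3) (criticalProbI 3)
      ({ω : BondConfig (Site 3) | ¬ ω ⊆ (zdGraph 3).edgeSet} ∪
        ⋃ x : Site 3, {ω : BondConfig (Site 3) | ∀ e : Sym2 (Site 3), ω \ {e} ∈ percolatesAt x}) = 0 := by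
  refine measure_union_null ?_ (measure_iUnion_null fun x => ?_)
  · have h : ∀ᵐ ω ∂(bondPercolation (zdGraph 3) (criticalProbI 3)), ω ⊆ (zdGraph 3).edgeSet :=
      setBernoulli_ae_subset
    exact ae_iff.1 h
  · rw [← measureReal_eq_zero_iff (measure_ne_top _ _), Necklace.real_backboneAt_eq]
    exact hNB

/-! ### Step 2: cofinal open bridges (the nesting lemma of the sibling file) -/

/-- Off `Bad`, a configuration in which the origin percolates has, for every `s`, an open lattice
edge `{x, y}` whose closure leaves the origin in a finite cluster of size `≥ s` containing `x`
(`Necklace.nesting`, `Necklace.exists_crossing`):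
`{0 ↔ ∞} ∖ Bad ⊆ ⋃_x ⋃_{y ∼ x} {ω | ω ∖ {x, y} ∈ A_s(x)}`. [folklore] -/
theorem percolatesAt_diff_subset (s : ℕ) :
    percolatesAt (0 : Site 3) \
        ({ω : BondConfig (Site 3) | ¬ ω ⊆ (zdGraph 3).edgeSet} ∪
          ⋃ x : Site 3, {ω : BondConfig (Site 3) | ∀ e : Sym2 (Site 3), ω \ {e} ∈ percolatesAt x}) ⊆
      ⋃ x : Site 3, ⋃ y ∈ (zdGraph 3).neighborFinset x,
        {ω : BondConfig (Site 3) | ω \ {s(x, y)} ∈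
          {ω : BondConfig (Site 3) | (openCluster ω 0).Finite ∧ s ≤ (openCluster ω 0).ncard ∧
            x ∈ openCluster ω 0}} := by
  rintro ω ⟨hperc, hgood⟩
  simp only [Set.mem_union, Set.mem_setOf_eq, Set.mem_iUnion, not_or, not_not, not_exists,
    not_forall] at hgood
  obtain ⟨hωE, hcut0⟩ := hgood
  have hcut : ∀ z : Site 3, (openCluster ω z).Infinite →
      ∃ e : Sym2 (Site 3), (openCluster (ω \ {e}) z).Finite := by
    intro z _
    obtain ⟨e, he⟩ := hcut0 z
    exact ⟨e, Set.not_infinite.1 he⟩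
  obtain ⟨e, -, hfin, hs⟩ := Necklace.nesting ω 0 hperc hcut s
  obtain ⟨u, v, rfl, hmem, -, hu, -⟩ := Necklace.exists_crossing ω e 0 hperc hfin
  have hadj : (zdGraph 3).Adj u v := (SimpleGraph.mem_edgeSet _).1 (hωE hmem)
  have hs' : s ≤ (openCluster (ω \ {s(u, v)}) 0).ncard := by
    rw [← hfin.cast_ncard_eq] at hs
    exact_mod_cast hs
  simp only [Set.mem_iUnion, Set.mem_setOf_eq, exists_prop]
  exact ⟨u, v, (SimpleGraph.mem_neighborFinset _ _ _).2 hadj, hfin, hs', hu⟩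

/-! ### Step 3: the events `A_s(x)` -/

/-- `A_s(x)` is measurable: `|C(0)| < ∞` is the complement of `{0 ↔ ∞}`, `x ∈ C(0)` is `{0 ↔ x}`,
and `s ≤ |C(0)|` (for finite `C(0)`) says that some finite set of `≥ s` vertices is joined to `0`.
[folklore] -/
theorem measurableSet_A (s : ℕ) (x : Site 3) :
    MeasurableSet {ω : BondConfig (Site 3) | (openCluster ω 0).Finite ∧
      s ≤ (openCluster ω 0).ncard ∧ x ∈ openCluster ω 0} := by
  have h : {ω : BondConfig (Site 3) | (openCluster ω 0).Finite ∧ s ≤ (openCluster ω 0).ncard ∧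
      x ∈ openCluster ω 0} = ((percolatesAt (0 : Site 3))ᶜ ∩
        ⋃ (T : Finset (Site 3)) (_ : s ≤ T.card), ⋂ y ∈ T, openConn (0 : Site 3) y) ∩
          openConn (0 : Site 3) x := by
    ext ω
    simp only [Set.mem_setOf_eq, Set.mem_inter_iff, Set.mem_compl_iff, Set.mem_iUnion,
      Set.mem_iInter, percolatesAt, openConn, Set.not_infinite, exists_prop]
    constructor
    · rintro ⟨hfin, hs, hx⟩
      refine ⟨⟨hfin, hfin.toFinset, ?_, fun y hy => ?_⟩, hx⟩
      · rwa [← Set.ncard_eq_toFinset_card _ hfin]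
      · exact (Set.Finite.mem_toFinset hfin).1 hy
    · rintro ⟨⟨hfin, T, hT, hTC⟩, hx⟩
      refine ⟨hfin, ?_, hx⟩
      calc s ≤ T.card := hT
        _ = (↑T : Set (Site 3)).ncard := (Set.ncard_coe_finset T).symm
        _ ≤ (openCluster ω 0).ncard := Set.ncard_le_ncard (fun y hy => hTC y hy) hfin
  rw [h]
  refine ((measurableSet_percolatesAt_holds (0 : Site 3)).compl.inter ?_).inter
    (measurableSet_openConn_holds (0 : Site 3) x)
  exact MeasurableSet.iUnion fun T => MeasurableSet.iUnion fun _ =>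
    MeasurableSet.biInter T.countable_toSet fun y _ => measurableSet_openConn_holds (0 : Site 3) y

/-- `A_s(x)` lies inside the truncated connection event `{0 ↔ x} ∖ {0 ↔ ∞}`. [folklore] -/
theorem A_subset (s : ℕ) (x : Site 3) :
    {ω : BondConfig (Site 3) | (openCluster ω 0).Finite ∧ s ≤ (openCluster ω 0).ncard ∧
        x ∈ openCluster ω 0} ⊆ openConn (0 : Site 3) x \ percolatesAt (0 : Site 3) :=
  fun _ ⟨hfin, _, hx⟩ => ⟨hx, fun h => h hfin⟩

/-- `P(A_s(x)) → 0` as `s → ∞` (for any finite measure `P`): the events decrease in `s` and have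
empty intersection (continuity from above). [folklore] -/
theorem tendsto_measureReal_A (P : Measure (BondConfig (Site 3))) [IsFiniteMeasure P] (x : Site 3) :
    Tendsto (fun s : ℕ => P.real {ω : BondConfig (Site 3) | (openCluster ω 0).Finite ∧
      s ≤ (openCluster ω 0).ncard ∧ x ∈ openCluster ω 0}) atTop (𝓝 0) := by
  have hanti : Antitone (fun s : ℕ => {ω : BondConfig (Site 3) | (openCluster ω 0).Finite ∧
      s ≤ (openCluster ω 0).ncard ∧ x ∈ openCluster ω 0}) :=
    fun s t hst ω ⟨hfin, ht, hx⟩ => ⟨hfin, hst.trans ht, hx⟩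
  have hinter : ⋂ s : ℕ, {ω : BondConfig (Site 3) | (openCluster ω 0).Finite ∧
      s ≤ (openCluster ω 0).ncard ∧ x ∈ openCluster ω 0} = ∅ := by
    refine Set.eq_empty_of_forall_notMem fun ω hω => ?_
    have h := Set.mem_iInter.1 hω ((openCluster ω 0).ncard + 1)
    exact absurd h.2.1 (by omega)
  have h := tendsto_measure_iInter_atTop (μ := P) (fun s => (measurableSet_A s x).nullMeasurableSet)
    hanti ⟨0, measure_ne_top _ _⟩
  rw [hinter, measure_empty] at h
  have h' := (ENNReal.tendsto_toReal ENNReal.zero_ne_top).comp h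
  rw [ENNReal.toReal_zero] at h'
  exact h'

/-! ### Step 4: deletion tolerance and the union bound -/

/-- **One-edge surgery costs a factor `1/(1 - p)`**: for `p < 1`, a measurable `E` and a pair `e`,
`P_p{ω | ω ∖ e ∈ E} ≤ P_p(E) / (1 - p)` (deletion tolerance of the product measure,
`bondPercolation_pow_mul_real_preimage_closeEdges_le` with `F = {e}`). [folklore] -/
theorem measureReal_setOf_sdiff_mem_le (p : unitInterval) (hp : (p : ℝ) < 1) (e : Sym2 (Site 3))
    {E : Set (BondConfig (Site 3))} (hE : MeasurableSet E) :
    (bondPercolation (zdGraph 3) p).real {ω : BondConfig (Site 3) | ω \ {e} ∈ E} ≤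
      (1 - (p : ℝ))⁻¹ * (bondPercolation (zdGraph 3) p).real E := by
  have h := bondPercolation_pow_mul_real_preimage_closeEdges_le (zdGraph 3) p {e} hE
  rw [Finset.card_singleton, pow_one, Finset.coe_singleton] at h
  have h' : (1 - (p : ℝ)) * (bondPercolation (zdGraph 3) p).real
      {ω : BondConfig (Site 3) | ω \ {e} ∈ E} ≤ (bondPercolation (zdGraph 3) p).real E := h
  have h1p : 0 < 1 - (p : ℝ) := sub_pos.2 hp
  calc (bondPercolation (zdGraph 3) p).real {ω : BondConfig (Site 3) | ω \ {e} ∈ E}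
      = (1 - (p : ℝ))⁻¹ * ((1 - (p : ℝ)) * (bondPercolation (zdGraph 3) p).real
          {ω : BondConfig (Site 3) | ω \ {e} ∈ E}) := by
        rw [← mul_assoc, inv_mul_cancel₀ h1p.ne', one_mul]
    _ ≤ (1 - (p : ℝ))⁻¹ * (bondPercolation (zdGraph 3) p).real E :=
        mul_le_mul_of_nonneg_left h' (inv_nonneg.2 h1p.le)

/-- **Union bound with one-edge surgery** (abstract form): if, off a `P_p`-null set `N`, the event
`S` forces `ω ∖ {x, y} ∈ A(x)` for some lattice edge `{x, y}`, with `A(x)` measurable and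
`Σ_x P_p(A(x)) < ∞`, then `P_p(S) ≤ 6/(1 - p) · Σ_x P_p(A(x))` (`p < 1`; each vertex of `ℤ³` has
`6` neighbours, `card_neighborFinset_zdGraph_holds`). [folklore] -/
theorem real_le_tsum_of_subset (p : unitInterval) (hp : (p : ℝ) < 1)
    {S N : Set (BondConfig (Site 3))} {A : Site 3 → Set (BondConfig (Site 3))}
    (hN : bondPercolation (zdGraph 3) p N = 0) (hA : ∀ x, MeasurableSet (A x))
    (hsub : S \ N ⊆ ⋃ x : Site 3, ⋃ y ∈ (zdGraph 3).neighborFinset x,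
      {ω : BondConfig (Site 3) | ω \ {s(x, y)} ∈ A x})
    (hsum : Summable fun x : Site 3 => (bondPercolation (zdGraph 3) p).real (A x)) :
    (bondPercolation (zdGraph 3) p).real S ≤
      6 * (1 - (p : ℝ))⁻¹ * ∑' x : Site 3, (bondPercolation (zdGraph 3) p).real (A x) := by
  set μ := bondPercolation (zdGraph 3) p with hμ
  have h1p : 0 < 1 - (p : ℝ) := sub_pos.2 hp
  -- Step A: remove the null set
  have h1 : μ S ≤ μ (⋃ x : Site 3, ⋃ y ∈ (zdGraph 3).neighborFinset x,
      {ω : BondConfig (Site 3) | ω \ {s(x, y)} ∈ A x}) :=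
    calc μ S = μ (S \ N) := (measure_sdiff_null hN).symm
      _ ≤ _ := measure_mono hsub
  -- Step B: union bounds
  have h2 : μ (⋃ x : Site 3, ⋃ y ∈ (zdGraph 3).neighborFinset x,
      {ω : BondConfig (Site 3) | ω \ {s(x, y)} ∈ A x}) ≤
      ∑' x : Site 3, ∑ y ∈ (zdGraph 3).neighborFinset x,
        μ {ω : BondConfig (Site 3) | ω \ {s(x, y)} ∈ A x} :=
    (measure_iUnion_le _).trans (ENNReal.tsum_le_tsum fun x => measure_biUnion_finset_le _ _)
  -- Step C: deletion tolerance at each of the six edges at `x`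
  have h3 : ∀ x : Site 3, ∑ y ∈ (zdGraph 3).neighborFinset x,
      μ {ω : BondConfig (Site 3) | ω \ {s(x, y)} ∈ A x} ≤
        ENNReal.ofReal (6 * (1 - (p : ℝ))⁻¹ * μ.real (A x)) := by
    intro x
    have hterm : ∀ y : Site 3, μ {ω : BondConfig (Site 3) | ω \ {s(x, y)} ∈ A x} ≤
        ENNReal.ofReal ((1 - (p : ℝ))⁻¹ * μ.real (A x)) := fun y =>
      calc μ {ω : BondConfig (Site 3) | ω \ {s(x, y)} ∈ A x}
          = ENNReal.ofReal (μ.real {ω : BondConfig (Site 3) | ω \ {s(x, y)} ∈ A x}) :=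
            (ofReal_measureReal (measure_ne_top _ _)).symm
        _ ≤ _ := ENNReal.ofReal_le_ofReal (measureReal_setOf_sdiff_mem_le p hp _ (hA x))
    calc ∑ y ∈ (zdGraph 3).neighborFinset x, μ {ω : BondConfig (Site 3) | ω \ {s(x, y)} ∈ A x}
        ≤ ∑ _y ∈ (zdGraph 3).neighborFinset x, ENNReal.ofReal ((1 - (p : ℝ))⁻¹ * μ.real (A x)) :=
          Finset.sum_le_sum fun y _ => hterm y
      _ = ENNReal.ofReal (6 * (1 - (p : ℝ))⁻¹ * μ.real (A x)) := by
          rw [Finset.sum_const, card_neighborFinset_zdGraph_holds x, nsmul_eq_mul, mul_assoc (6 : ℝ),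
            ENNReal.ofReal_mul (by norm_num : (0 : ℝ) ≤ 6), ENNReal.ofReal_ofNat]
          norm_num
  -- Step D: sum over `x`
  have h4 : ∑' x : Site 3, ENNReal.ofReal (6 * (1 - (p : ℝ))⁻¹ * μ.real (A x)) =
      ENNReal.ofReal (6 * (1 - (p : ℝ))⁻¹ * ∑' x : Site 3, μ.real (A x)) := by
    rw [← tsum_mul_left, ENNReal.ofReal_tsum_of_nonneg (fun x => ?_) (hsum.mul_left _)]
    exact mul_nonneg (mul_nonneg (by norm_num) (inv_nonneg.2 h1p.le)) measureReal_nonneg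
  have h5 : μ S ≤ ENNReal.ofReal (6 * (1 - (p : ℝ))⁻¹ * ∑' x : Site 3, μ.real (A x)) :=
    calc μ S ≤ _ := h1
      _ ≤ _ := h2
      _ ≤ ∑' x : Site 3, ENNReal.ofReal (6 * (1 - (p : ℝ))⁻¹ * μ.real (A x)) :=
          ENNReal.tsum_le_tsum h3
      _ = _ := h4
  exact ENNReal.toReal_le_of_le_ofReal (mul_nonneg (mul_nonneg (by norm_num) (inv_nonneg.2 h1p.le))
    (tsum_nonneg fun x => measureReal_nonneg)) h5

/-- **The surgery inequality**: under `NoBackbone`, for every `s`,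
`θ(p_c) ≤ 6/(1 - p_c) · Σ_x P_{p_c}(A_s(x))` whenever the right-hand side is summable
(Steps 1–2 and `real_le_tsum_of_subset`; `p_c(ℤ³) < 1` by `criticalProb_zd_lt_one`). [folklore] -/
theorem real_percolatesAt_le
    (hNB : Summit.CriticalPhenomena.PercolationContinuityZ3.Theses.PercNecklaceBackbone.NoBackbone)
    (s : ℕ) (hsum : Summable fun x : Site 3 => (bondPercolation (zdGraph 3) (criticalProbI 3)).real
      {ω : BondConfig (Site 3) | (openCluster ω 0).Finite ∧ s ≤ (openCluster ω 0).ncard ∧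
        x ∈ openCluster ω 0}) :
    (bondPercolation (zdGraph 3) (criticalProbI 3)).real (percolatesAt (0 : Site 3)) ≤
      6 * (1 - (criticalProbI 3 : ℝ))⁻¹ *
        ∑' x : Site 3, (bondPercolation (zdGraph 3) (criticalProbI 3)).real
          {ω : BondConfig (Site 3) | (openCluster ω 0).Finite ∧ s ≤ (openCluster ω 0).ncard ∧
            x ∈ openCluster ω 0} := by
  have hp1 : ((criticalProbI 3 : unitInterval) : ℝ) < 1 := by
    rw [coe_criticalProbI]; exact criticalProb_zd_lt_one (by norm_num)
  exact real_le_tsum_of_subset (criticalProbI 3) hp1 (measure_bad_eq_zero hNB)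
    (measurableSet_A s) (percolatesAt_diff_subset s) hsum

/-! ### Step 5: Tannery's theorem and the conclusion -/

/-- **Tannery step** (abstract form): if `θ ≤ K · Σ_x P(A_s(x))` for every `s` (whenever the sum
converges), the events `A_s(x) ⊆ T(x)` are dominated by a summable family `P(T(x))`, and
`P(A_s(x)) → 0` for each `x`, then `θ ≤ 0` (`tendsto_tsum_of_dominated_convergence`). [folklore] -/
theorem le_zero_of_forall_le_tsum {ι : Type*} (P : Measure (BondConfig (Site 3))) [IsFiniteMeasure P]
    {A : ℕ → ι → Set (BondConfig (Site 3))} {T : ι → Set (BondConfig (Site 3))} {θ K : ℝ}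
    (hAT : ∀ s x, A s x ⊆ T x) (hsum : Summable fun x => P.real (T x))
    (hlimA : ∀ x, Tendsto (fun s => P.real (A s x)) atTop (𝓝 0))
    (hkey : ∀ s, Summable (fun x => P.real (A s x)) → θ ≤ K * ∑' x, P.real (A s x)) : θ ≤ 0 := by
  have hAle : ∀ s x, P.real (A s x) ≤ P.real (T x) :=
    fun s x => measureReal_mono (hAT s x) (measure_ne_top _ _)
  have hsumA : ∀ s, Summable fun x => P.real (A s x) := fun s =>
    Summable.of_nonneg_of_le (fun x => measureReal_nonneg) (hAle s) hsum
  have hlim : Tendsto (fun s : ℕ => ∑' x, P.real (A s x)) atTop (𝓝 0) := by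
    have h := tendsto_tsum_of_dominated_convergence (𝓕 := (atTop : Filter ℕ))
      (f := fun (s : ℕ) x => P.real (A s x)) (g := fun _ => (0 : ℝ)) (bound := fun x => P.real (T x))
      hsum hlimA (Eventually.of_forall fun s x => by
        rw [Real.norm_eq_abs, abs_of_nonneg measureReal_nonneg]; exact hAle s x)
    simpa only [tsum_zero] using h
  have hl := hlim.const_mul K
  rw [mul_zero] at hl
  exact ge_of_tendsto hl (Eventually.of_forall fun s => hkey s (hsumA s))

/-- **`NecklaceFatTails`** (route `PercNecklaceBackbone`, item stmt-CriticalPhenomena-5273): if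
`P_{p_c}`-a.s. some single-edge closure disconnects the origin from infinity (`NoBackbone`) and
`θ(p_c) > 0`, then the truncated connectivity `x ↦ P_{p_c}(0 ↔ x, |C(0)| < ∞)` is not summable
(`χᶠ(p_c) = ∞`). One-edge surgery: by `real_percolatesAt_le`,
`θ(p_c) ≤ 6/(1 − p_c) · Σ_x P(A_s(x))` for every `s`, while `A_s(x) ⊆ {0 ↔ x, |C(0)| < ∞}`
decreases to `∅`, so Tannery's theorem sends the right-hand side to `0`. [folklore] -/
theorem necklaceFatTails_proof :
    Summit.CriticalPhenomena.PercolationContinuityZ3.Theses.PercNecklaceBackbone.NecklaceFatTails := by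
  intro hNB hθ hsum
  have hle : (bondPercolation (zdGraph 3) (criticalProbI 3)).real (percolatesAt (0 : Site 3)) ≤ 0 :=
    le_zero_of_forall_le_tsum (bondPercolation (zdGraph 3) (criticalProbI 3))
      (A := fun (s : ℕ) (x : Site 3) => {ω : BondConfig (Site 3) | (openCluster ω 0).Finite ∧
        s ≤ (openCluster ω 0).ncard ∧ x ∈ openCluster ω 0})
      A_subset hsum (tendsto_measureReal_A _) (real_percolatesAt_le hNB)
  have hθ' : theta (zdGraph 3) (0 : Site 3) (criticalProbI 3) =
      (bondPercolation (zdGraph 3) (criticalProbI 3)).real (percolatesAt (0 : Site 3)) := rfl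
  linarith

end PercNecklaceBackboneNecklaceFatTails

end Summit.CriticalPhenomena.PercolationContinuityZ3.Theorems

end
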